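import Summits.Ventures.HSemireg.ContractionSpanPartialFourierRank
import Summits.Ventures.HSemireg.ContractionSpanTwist
import Summits.Ventures.HSemireg.ContractionRankPointPairBox
import Summits.Ventures.HSemireg.AmplificationChainG4Transport
import HarnessLib

/-!
# Venture HSemireg — `contractionRank` is invariant under the partial Fourier transform on the REAL carriers, and the
# g = 4 rank row with `r(P, ch E)` EVALUATED to `18` for a class of T4a shape (sheared point-pair box, partially transformed, twisted)

HONEST FRAMING. Lean index of the computation cell `pub-hsemireg` (seat p4). Compositions of kernel theorems over the
carriers of `PerfectComplexRankDoor.lean` (`contractionRank`, `totalExteriorClass`, `hodgeZeroOneSet`, `vectorFieldSet`);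
every geometric identification is a hypothesis BY VALUE, exactly as in seat p6's `contractionRank_eq_of_fourier_transport`
and seat p4's `contractionRank_pointPairBox_two`. Nothing here is a claim about any explicit variety; nothing here says that
HC / HC_CM / HC_AV holds (split Weil abelian fourfolds are IN PRINT, [Markman2023GeneralizedKummers] Thm. 1.3, and are
RE-DERIVED modulo the named hypotheses exactly as in `AmplificationChainG4Transport.lean`). Everything is PROVED; no `def`, no
named fact, no `sorry`.

WHAT THIS FILE DOES. The census certificate (I2-β) «`18 ≤ r(𝓔) = 18`» of the g = 4 object `𝓔 = E₀ ⊗ M_B`,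
`E₀ = Φ(I_{p×X ∪ X×q})` on `A₀ = X × X̂` (`step0/T4a/README-T4a.md`) had BOTH numbers by value. Its right side is a function
of the class SHAPE: `ch(E₀) = F₂(μ^* ch(I_p ⊠ I_q))` where `μ^*` is the shear of Orlov's `Φ = (id × Φ_𝒫) ∘ μ_*` (a linear
automorphism of `H¹(X × X)` preserving `H^{0,1}`) and `F₂` the Fourier–Mukai transform along the second factor, read in `Λ H¹`.
1. `image_annihilator_eq`: bookkeeping — a linear isomorphism carries the annihilator of a set to the annihilator of its image.
2. **`contractionRank_eq_of_partialFourier_transport`**: for abelian varieties `A` (source) and `A'` (target), identifications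
   BY VALUE `g : H¹(A) ≅ V₁ × V₂`, `g' : H¹(A') ≅ V₁ × V₂^*` carrying `H^{0,1}(A)` onto `L₁ × L₂` and `H^{0,1}(A')` onto
   `L₁ × Ann L₂` (Künneth + `H¹(X̂₂) = H¹(X₂)^*` with `H^{0,1}(X̂₂) = Ann H^{0,1}(X₂)`), and the class identity
   `Λg'(Σ κ'_p) = F₂(Λg(Σ κ_p))`: `contractionRank A' κ' = contractionRank A κ` (part 3's `rank_span_partialFourier_eq` + p6's
   iso-transport `rank_span_map_equiv`).
3. **`contractionRank_eq_eighteen_of_partialFourier`**: if moreover `dim A = 4` and the source class is a point-pair box in a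
   splitting of `H¹(A)` (p4's `contractionRank_pointPairBox_two` binders, e.g. the `μ`-SHEARED Künneth splitting), and the target
   class is further twisted by `e^{c}` with `c` of type `span{v ∧ q : q ∈ H^{0,1}}` (p6's `rank_span_mul_expSum_eq`; `c = c₁(M_B)`),
   then `contractionRank A' κ'' = 18`; `contractionRank_eq_of_partialFourier_pointPairBox`: the same on a `2n`-fold, `n ≥ 3`
   (`6n² − 2n`, e.g. `48` at `n = 3` — the split sixfold method-instance rows of T4a type).
4. **`weilFourfoldsSplit_of_reach_of_perfectComplexRankTransfer_of_extRank_eq_of_partialFourier`**: seat p7's functor-free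
   g = 4 TIER-2 row (`AmplificationChainG4Transport.lean` §3, red-5 V16) with the rank binder in the NUMERAL form
   `h2 : extRank Y₀ G 2 ≤ 18` plus the frame binders of item 3 for `κ'' = ch(E)`; every other binder verbatim.
SATISFIABILITY CHECK for T4a (seat script `HOME/p4/fmcheck/fm_partial_check.py` 4e9c7d44246dfcd5 → `.out.txt` 50c51794e3feb345,
exact exterior-algebra arithmetic, < 1 s): with the shear `μ^*(eᵢ) = eᵢ + e′ᵢ`, `μ^*(e′ᵢ) = e′ᵢ` and `F₂ = partialFourier` AS
DEFINED IN PART 2 (dual basis `lᵢ`, `ω′ = l₄l₃l₂l₁`), one gets `F₂(μ^*((1 − pt) ⊠ (1 − pt))) = −1 − e^{+c} + pt_X + pt_X̂` with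
`c = Σ eᵢ ∧ lᵢ` (18 terms), which is `README-T4a` §2's `ch(E₀) = −1 − e^{−c} + pt_X + pt_X̂` after `lᵢ ↦ −lᵢ` on the dual factor
(the `𝒫 ↔ 𝒫^∨` / `Φ_𝒫 ↔ Φ_𝒫⁻¹` normalisation — a linear automorphism preserving `L₁ × Ann L₂`, absorbed in `g'`): the class
identity `hF` below IS instantiable for the cell's object, with all four box coefficients `= ±1 ≠ 0`.
BY VALUE (th-2's dictionary instantiates them): `g`, `g'`, the Hodge compatibilities `hL`/`hL'`, the splitting and box
coefficients on the source, the class identities `hbox` / `hF` / `htw`, `dim Ext²(𝓔,𝓔) = 18`; BY NAME: `weilFamilyReach_hyperbolic`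
(refereed), `PerfectComplexRankTransfer C` (assumption; F-1). WHAT MOVES: the right side of (I2-β) becomes kernel output of the
class shape (th-2 `ht2rank4` / gs-eng-2 are its ×2). References: [BourbakiAlgebre1a3] Ch. III §11; [Mukai1981] Thm. 2.2;
[Orlov2002DerivedAbelian] Assertion 2.8; [BuchweitzFlenner2008HH] Prop. 6.4.4; [Markman2023GeneralizedKummers] Thm. 1.3.
-/

noncomputable section

open CategoryTheory AlgebraicGeometry Set
open CliffordAlgebra (contractLeft)
open ExteriorAlgebra (ι)
open Module
open Literature.AlgebraicGeometry.Motives Literature.AlgebraicGeometry.HodgeTheory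
open Literature.AlgebraicGeometry.ModuliOfAbelianVarieties Literature.AlgebraicGeometry.Deligne1982
open Literature.AlgebraicGeometry.KTheory
open Literature.AlgebraicTopology.SingularHomology

namespace Summit.Ventures.HSemireg

/-! ## §1 Bookkeeping: annihilators under a linear isomorphism -/

section Annihilator

variable {K : Type*} [Field K] {V W : Type*} [AddCommGroup V] [Module K V] [AddCommGroup W] [Module K W]

/-- A linear isomorphism `g` carries the annihilator of `S` (composed with `g⁻¹`) onto the annihilator of `g(S)`.
[cite: BourbakiAlgebre1a3, Ch. II §2 no. 4] -/
theorem image_annihilator_eq (g : V ≃ₗ[K] W) (S : Set V) :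
    (fun θ : Module.Dual K V => θ ∘ₗ g.symm.toLinearMap) '' {θ | ∀ q ∈ S, θ q = 0} =
      {θ' : Module.Dual K W | ∀ q' ∈ g '' S, θ' q' = 0} := by
  ext θ'
  simp only [Set.mem_image, Set.mem_setOf_eq]
  constructor
  · rintro ⟨θ, hθ, rfl⟩ q' ⟨q, hq, rfl⟩
    rw [LinearMap.comp_apply, LinearEquiv.coe_coe, LinearEquiv.symm_apply_apply]
    exact hθ q hq
  · intro h
    refine ⟨θ' ∘ₗ g.toLinearMap, fun q hq => h (g q) ⟨q, hq, rfl⟩, ?_⟩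
    ext w
    simp only [LinearMap.comp_apply, LinearEquiv.coe_coe, LinearEquiv.apply_symm_apply]

end Annihilator

/-! ## §2 `contractionRank` under the partial Fourier transform (real carriers, identifications by value) -/

section Transport

variable {V₁ V₂ : Type} [AddCommGroup V₁] [Module ℂ V₁] [AddCommGroup V₂] [Module ℂ V₂] [FiniteDimensional ℂ V₂]
variable {n : ℕ} (b₂ : Module.Basis (Fin n) ℂ V₂) (L₁ : Submodule ℂ V₁) (L₂ : Submodule ℂ V₂)

/-- **`r(A', κ') = r(A, κ)` along a PARTIAL Fourier transform (class-level H-FM for `Φ = id × Φ_𝒫`).** Identifications BY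
VALUE: `g : H¹(A) ≅ V₁ × V₂` with `g(H^{0,1}(A)) = L₁ × L₂`, `g' : H¹(A') ≅ V₁ × V₂^*` with `g'(H^{0,1}(A')) = L₁ × Ann L₂`, and
`Λg'(Σ κ'_p) = F₂(Λg(Σ κ_p))` (`F₂ = partialFourier b₂`). [cite: Mukai1981, Thm. 2.2]
[cite: BourbakiAlgebre1a3, Ch. III §11 no. 11 Prop. 12] [cite: BuchweitzFlenner2008HH, Prop. 6.4.4] -/
theorem contractionRank_eq_of_partialFourier_transport (A A' : AbelianVariety ℂ)
    (κ : ∀ p : ℕ, complexBetti A.X (2 * p)) (κ' : ∀ p : ℕ, complexBetti A'.X (2 * p))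
    (g : complexBetti A.X 1 ≃ₗ[ℂ] V₁ × V₂) (g' : complexBetti A'.X 1 ≃ₗ[ℂ] V₁ × Module.Dual ℂ V₂)
    (hL : ⇑g '' hodgeZeroOneSet A = (L₁.prod L₂ : Set (V₁ × V₂)))
    (hL' : ⇑g' '' hodgeZeroOneSet A' = (L₁.prod L₂.dualAnnihilator : Set (V₁ × Module.Dual ℂ V₂)))
    (hx : ExteriorAlgebra.map g'.toLinearMap (totalExteriorClass A' κ') =
      ContractionSpan.partialFourier b₂ (ExteriorAlgebra.map g.toLinearMap (totalExteriorClass A κ))) :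
    contractionRank A' κ' = contractionRank A κ := by
  have hΘ : (fun θ : Module.Dual ℂ (complexBetti A.X 1) => θ ∘ₗ g.symm.toLinearMap) '' vectorFieldSet A =
      {θ | ∀ q ∈ L₁.prod L₂, θ q = 0} := by
    rw [vectorFieldSet, image_annihilator_eq, hL]; rfl
  have hΘ' : (fun θ : Module.Dual ℂ (complexBetti A'.X 1) => θ ∘ₗ g'.symm.toLinearMap) '' vectorFieldSet A' =
      {θ' | ∀ q' ∈ L₁.prod L₂.dualAnnihilator, θ' q' = 0} := by
    rw [vectorFieldSet, image_annihilator_eq, hL']; rfl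
  rw [contractionRank_eq_rank_span A' κ', contractionRank_eq_rank_span A κ,
    ← ContractionSpan.rank_span_map_equiv g', ← ContractionSpan.rank_span_map_equiv g, hL, hL', hΘ, hΘ', hx,
    ← ContractionSpan.rank_span_partialFourier_eq]

variable {A A' : AbelianVariety ℂ} {W₁ W₂ M₁ M₂ : Submodule ℂ (complexBetti A.X 1)}

/-- **`r(A', κ'') = 18` for a class of T4a shape.** Source: an abelian FOURFOLD `A` with a class `κ` whose total class is a
point-pair box `(a₁ + b₁ω₁) ∧ (a₂ + b₂ω₂)` in a splitting `H¹(A) = W₁ ⊕ W₂`, `H^{0,1}(A) = M₁ ⊕ M₂` (BY VALUE — e.g. the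
`μ`-sheared Künneth frame of `X × X` for `ch(μ_*(I_p ⊠ I_q))`); transport BY VALUE as in
`contractionRank_eq_of_partialFourier_transport` to `κ'` on `A'`; then a twist `Σ κ''_p = (Σ κ'_p) ∧ e^{c}` with `c` of type
`span{v ∧ q : q ∈ H^{0,1}(A')}`, `c^N = 0` (`ch(E₀ ⊗ M_B) = ch(E₀) e^{c₁(M_B)}`, BY VALUE). Conclusion: `contractionRank A' κ'' = 18`.
[cite: BuchweitzFlenner2008HH, Prop. 6.4.4] [cite: Mukai1981, Thm. 2.2] [cite: MumfordAV1970, §1 (4) and §4 (iii)] -/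
theorem contractionRank_eq_eighteen_of_partialFourier (hA : IsSmoothProjective A.dim A.X)
    (κ : ∀ p : ℕ, complexBetti A.X (2 * p)) (κ' κ'' : ∀ p : ℕ, complexBetti A'.X (2 * p))
    -- the point-pair box on the source (p4's `contractionRank_pointPairBox_two` binders)
    (hW : IsCompl W₁ W₂) (hW₁ : Module.finrank ℂ W₁ = 4) (hW₂ : Module.finrank ℂ W₂ = 4)
    (hM : hodgeZeroOne hA = M₁ ⊔ M₂) (hM₁ : M₁ ≤ W₁) (hM₂ : M₂ ≤ W₂)
    (hm₁ : Module.finrank ℂ M₁ = 2) (hm₂ : Module.finrank ℂ M₂ = 2)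
    {ω₁ : ExteriorAlgebra ℂ W₁} (hω₁ : ω₁ ∈ ⋀[ℂ]^4 W₁) (hω₁0 : ω₁ ≠ 0)
    {ω₂ : ExteriorAlgebra ℂ W₂} (hω₂ : ω₂ ∈ ⋀[ℂ]^4 W₂) (hω₂0 : ω₂ ≠ 0)
    {a₁ b₁ a₂ b₂' : ℂ} (ha₁ : a₁ ≠ 0) (hb₁ : b₁ ≠ 0) (ha₂ : a₂ ≠ 0) (hb₂ : b₂' ≠ 0)
    (hbox : totalExteriorClass A κ =
      ExteriorAlgebra.map W₁.subtype (algebraMap ℂ _ a₁ + b₁ • ω₁) * ExteriorAlgebra.map W₂.subtype (algebraMap ℂ _ a₂ + b₂' • ω₂))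
    -- the partial Fourier transport to the target
    (g : complexBetti A.X 1 ≃ₗ[ℂ] V₁ × V₂) (g' : complexBetti A'.X 1 ≃ₗ[ℂ] V₁ × Module.Dual ℂ V₂)
    (hL : ⇑g '' hodgeZeroOneSet A = (L₁.prod L₂ : Set (V₁ × V₂)))
    (hL' : ⇑g' '' hodgeZeroOneSet A' = (L₁.prod L₂.dualAnnihilator : Set (V₁ × Module.Dual ℂ V₂)))
    (hF : ExteriorAlgebra.map g'.toLinearMap (totalExteriorClass A' κ') =
      ContractionSpan.partialFourier b₂ (ExteriorAlgebra.map g.toLinearMap (totalExteriorClass A κ)))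
    -- the twist on the target
    {c : ExteriorAlgebra ℂ (complexBetti A'.X 1)}
    (hc : c ∈ Submodule.span ℂ {z : ExteriorAlgebra ℂ (complexBetti A'.X 1) |
      ∃ v : complexBetti A'.X 1, ∃ q ∈ hodgeZeroOneSet A', z = ι ℂ v * ι ℂ q}) {N : ℕ} (hN : c ^ N = 0)
    (htw : totalExteriorClass A' κ'' = totalExteriorClass A' κ' * ∑ k ∈ Finset.range N, ((k.factorial : ℂ)⁻¹) • c ^ k) :
    contractionRank A' κ'' = 18 := by
  rw [contractionRank_eq_of_totalExteriorClass_eq_mul_expSum A' hc hN htw,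
    contractionRank_eq_of_partialFourier_transport b₂ L₁ L₂ A A' κ κ' g g' hL hL' hF]
  exact contractionRank_pointPairBox_two hA κ hW hW₁ hW₂ hM hM₁ hM₂ hm₁ hm₂ hω₁ hω₁0 hω₂ hω₂0 ha₁ hb₁ ha₂ hb₂ hbox

/-- **`r(A', κ'') = 6n² − 2n` for a class of T4a shape on a `2n`-fold target, `n ≥ 3`** (e.g. `48` for `X` an abelian
THREEFOLD, `A' = X × X̂`): the same composition with p4's `contractionRank_pointPairBox` (`dim Wᵢ = 2n`, `dim Mᵢ = n`) in place of
the fourfold case. [cite: BuchweitzFlenner2008HH, Prop. 6.4.4] [cite: Mukai1981, Thm. 2.2] [cite: MumfordAV1970, §1 (4) and §4 (iii)] -/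
theorem contractionRank_eq_of_partialFourier_pointPairBox (hA : IsSmoothProjective A.dim A.X)
    (κ : ∀ p : ℕ, complexBetti A.X (2 * p)) (κ' κ'' : ∀ p : ℕ, complexBetti A'.X (2 * p)) {m : ℕ} (hm : 3 ≤ m)
    (hW : IsCompl W₁ W₂) (hW₁ : Module.finrank ℂ W₁ = 2 * m) (hW₂ : Module.finrank ℂ W₂ = 2 * m)
    (hM : hodgeZeroOne hA = M₁ ⊔ M₂) (hM₁ : M₁ ≤ W₁) (hM₂ : M₂ ≤ W₂)
    (hm₁ : Module.finrank ℂ M₁ = m) (hm₂ : Module.finrank ℂ M₂ = m)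
    {ω₁ : ExteriorAlgebra ℂ W₁} (hω₁ : ω₁ ∈ ⋀[ℂ]^(2 * m) W₁) (hω₁0 : ω₁ ≠ 0)
    {ω₂ : ExteriorAlgebra ℂ W₂} (hω₂ : ω₂ ∈ ⋀[ℂ]^(2 * m) W₂) (hω₂0 : ω₂ ≠ 0)
    {a₁ b₁ a₂ b₂' : ℂ} (ha₁ : a₁ ≠ 0) (hb₁ : b₁ ≠ 0) (ha₂ : a₂ ≠ 0) (hb₂ : b₂' ≠ 0)
    (hbox : totalExteriorClass A κ =
      ExteriorAlgebra.map W₁.subtype (algebraMap ℂ _ a₁ + b₁ • ω₁) * ExteriorAlgebra.map W₂.subtype (algebraMap ℂ _ a₂ + b₂' • ω₂))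
    (g : complexBetti A.X 1 ≃ₗ[ℂ] V₁ × V₂) (g' : complexBetti A'.X 1 ≃ₗ[ℂ] V₁ × Module.Dual ℂ V₂)
    (hL : ⇑g '' hodgeZeroOneSet A = (L₁.prod L₂ : Set (V₁ × V₂)))
    (hL' : ⇑g' '' hodgeZeroOneSet A' = (L₁.prod L₂.dualAnnihilator : Set (V₁ × Module.Dual ℂ V₂)))
    (hF : ExteriorAlgebra.map g'.toLinearMap (totalExteriorClass A' κ') =
      ContractionSpan.partialFourier b₂ (ExteriorAlgebra.map g.toLinearMap (totalExteriorClass A κ)))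
    {c : ExteriorAlgebra ℂ (complexBetti A'.X 1)}
    (hc : c ∈ Submodule.span ℂ {z : ExteriorAlgebra ℂ (complexBetti A'.X 1) |
      ∃ v : complexBetti A'.X 1, ∃ q ∈ hodgeZeroOneSet A', z = ι ℂ v * ι ℂ q}) {N : ℕ} (hN : c ^ N = 0)
    (htw : totalExteriorClass A' κ'' = totalExteriorClass A' κ' * ∑ k ∈ Finset.range N, ((k.factorial : ℂ)⁻¹) • c ^ k) :
    contractionRank A' κ'' = ((6 * m ^ 2 - 2 * m : ℕ) : Cardinal) := by
  rw [contractionRank_eq_of_totalExteriorClass_eq_mul_expSum A' hc hN htw,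
    contractionRank_eq_of_partialFourier_transport b₂ L₁ L₂ A A' κ κ' g g' hL hL' hF]
  exact contractionRank_pointPairBox hA κ hm hW hW₁ hW₂ hM hM₁ hM₂ hm₁ hm₂ hω₁ hω₁0 hω₂ hω₂0 ha₁ hb₁ ha₂ hb₂ hbox

end Transport

/-! ## §3 The g = 4 TIER-2 rank row with `r(P, ch E)` evaluated through the partial Fourier transport -/

section G4

open Summit.HodgeConjecture.HodgeConjecture
open Summit.HodgeConjecture.HodgeConjecture.WeilTypeLadder
open Summit.HodgeConjecture.HodgeConjecture.Cruxes.HodgeAbelianVarieties.EStepSecantInduction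
open Summit.Ventures.HSemireg.GeneralStructure

variable {C : ChernCharacterBetti}
variable {V₁ V₂ : Type} [AddCommGroup V₁] [Module ℂ V₁] [AddCommGroup V₂] [Module ℂ V₂] [FiniteDimensional ℂ V₂]
variable {n : ℕ} (b₂ : Module.Basis (Fin n) ℂ V₂) (L₁ : Submodule ℂ V₁) (L₂ : Submodule ℂ V₂)
variable {Asrc : AbelianVariety ℂ} {W₁ W₂ M₁ M₂ : Submodule ℂ (complexBetti Asrc.X 1)}

/-- **g = 4, TIER 2, functor-free, `r` EVALUATED by the partial Fourier transport**: seat p7's row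
`weilFourfoldsSplit_of_reach_of_perfectComplexRankTransfer_of_extRank_eq` with `h2 : extRank Y₀ G 2 ≤ 18` — the right side
of (I2-β) supplied by `contractionRank_eq_eighteen_of_partialFourier` from the frame binders BY VALUE: a source abelian
fourfold `Asrc` (for the cell: `X × X`) with a point-pair box class `κs` (`ch(μ_*(I_p ⊠ I_q))` in the sheared Künneth frame),
the transport data `g, g', hL, hL'` to `P` (`= X × X̂`), the class identity `hF` for the untwisted class `κ₀` (`ch E₀`) and
the twist `htw` for `κ = ch(E)` (`ch 𝓔 = ch E₀ ∧ e^{c₁(M_B)}`). Everything else verbatim; `hF'`/`hT` BY NAME as there.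
[cite: Markman2023GeneralizedKummers, Theorem 1.3 (the case in print)] [cite: BuchweitzFlenner2008HH, Prop. 6.4.4]
[cite: Mukai1981, Thm. 2.2] [cite: Orlov2002DerivedAbelian, Assertion 2.8] -/
theorem weilFourfoldsSplit_of_reach_of_perfectComplexRankTransfer_of_extRank_eq_of_partialFourier
    (hF' : weilFamilyReach_hyperbolic) (hT : PerfectComplexRankTransfer C) {d : ℕ} (hd : 0 < d)
    (P : AbelianVariety ℂ) (ψ₀ : P ⟶ P) (e : ProjectiveEmbedding P.X) (a : complexBetti (projectiveSpace e.n ℂ) 2)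
    (hP : P.dim = 2 * 2) (hψ : ψ₀ ≫ ψ₀ = -(d • 𝟙 P)) (ha : IsRationalClass a) (ha0 : a ≠ 0)
    (hhyp : IsHyperbolicWeilType P ψ₀ 2 (symmetrisedClass d P ψ₀ e a))
    (w : complexBetti P.X (2 * 2)) (hwW : w ∈ weilClassesOf P ψ₀ 2 d) (hwr : IsRationalClass w) (hw0 : w ≠ 0)
    (I : Finset ℕ) (hI : ∀ p : ℕ, 1 ≤ p → p ≤ 2 * 2 → p ∈ I) (E : CochainComplex P.X.left.Modules ℤ)
    (hE : IsBoundedVBComplex E) (q : ℚ) (cq : ℕ → ℚ)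
    (hch2 : chPerfect C P.X E hE.isFiniteLocallyFree 2 = ((q : ℚ) : ℂ) • cupPowTwo (symmetrisedClass d P ψ₀ e a) 2 + w)
    (hchp : ∀ p ∈ I, p ≠ 2 →
      chPerfect C P.X E hE.isFiniteLocallyFree p = ((cq p : ℚ) : ℂ) • cupPowTwo (symmetrisedClass d P ψ₀ e a) p)
    {Y₀ : SchemeOver ℂ} (G : CochainComplex Y₀.left.Modules ℤ)
    (hext : ∀ m : ℤ, m ≤ 2 → extRank P.X E m = extRank Y₀ G m)
    (hneg : ∀ k : ℤ, k < 0 → extRank Y₀ G k = 0) (h0 : extRank Y₀ G 0 = 1)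
    (h2 : extRank Y₀ G 2 ≤ 18)
    -- the source box (BY VALUE)
    (hAsrc : IsSmoothProjective Asrc.dim Asrc.X) (κs : ∀ p : ℕ, complexBetti Asrc.X (2 * p))
    (hW : IsCompl W₁ W₂) (hW₁ : Module.finrank ℂ W₁ = 4) (hW₂ : Module.finrank ℂ W₂ = 4)
    (hM : hodgeZeroOne hAsrc = M₁ ⊔ M₂) (hM₁ : M₁ ≤ W₁) (hM₂ : M₂ ≤ W₂)
    (hm₁ : Module.finrank ℂ M₁ = 2) (hm₂ : Module.finrank ℂ M₂ = 2)
    {ω₁ : ExteriorAlgebra ℂ W₁} (hω₁ : ω₁ ∈ ⋀[ℂ]^4 W₁) (hω₁0 : ω₁ ≠ 0)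
    {ω₂ : ExteriorAlgebra ℂ W₂} (hω₂ : ω₂ ∈ ⋀[ℂ]^4 W₂) (hω₂0 : ω₂ ≠ 0)
    {a₁ b₁ a₂ b₂' : ℂ} (ha₁ : a₁ ≠ 0) (hb₁ : b₁ ≠ 0) (ha₂ : a₂ ≠ 0) (hb₂ : b₂' ≠ 0)
    (hbox : totalExteriorClass Asrc κs =
      ExteriorAlgebra.map W₁.subtype (algebraMap ℂ _ a₁ + b₁ • ω₁) * ExteriorAlgebra.map W₂.subtype (algebraMap ℂ _ a₂ + b₂' • ω₂))
    -- the transport and the untwisted target class (BY VALUE)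
    (κ₀ : ∀ p : ℕ, complexBetti P.X (2 * p))
    (g : complexBetti Asrc.X 1 ≃ₗ[ℂ] V₁ × V₂) (g' : complexBetti P.X 1 ≃ₗ[ℂ] V₁ × Module.Dual ℂ V₂)
    (hL : ⇑g '' hodgeZeroOneSet Asrc = (L₁.prod L₂ : Set (V₁ × V₂)))
    (hL' : ⇑g' '' hodgeZeroOneSet P = (L₁.prod L₂.dualAnnihilator : Set (V₁ × Module.Dual ℂ V₂)))
    (hF : ExteriorAlgebra.map g'.toLinearMap (totalExteriorClass P κ₀) =
      ContractionSpan.partialFourier b₂ (ExteriorAlgebra.map g.toLinearMap (totalExteriorClass Asrc κs)))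
    -- the twist (BY VALUE)
    {c : ExteriorAlgebra ℂ (complexBetti P.X 1)}
    (hc : c ∈ Submodule.span ℂ {z : ExteriorAlgebra ℂ (complexBetti P.X 1) |
      ∃ v : complexBetti P.X 1, ∃ q ∈ hodgeZeroOneSet P, z = ι ℂ v * ι ℂ q}) {N : ℕ} (hN : c ^ N = 0)
    (htw : totalExteriorClass P (fun p ↦ chPerfect C P.X E hE.isFiniteLocallyFree p) =
      totalExteriorClass P κ₀ * ∑ k ∈ Finset.range N, ((k.factorial : ℂ)⁻¹) • c ^ k) :
    Stubs.WeilAlgebraicSplitHyperplane 2 d := by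
  have hr : contractionRank P (fun p ↦ chPerfect C P.X E hE.isFiniteLocallyFree p) = 18 :=
    contractionRank_eq_eighteen_of_partialFourier b₂ L₁ L₂ hAsrc κs κ₀ _ hW hW₁ hW₂ hM hM₁ hM₂ hm₁ hm₂ hω₁ hω₁0 hω₂ hω₂0
      ha₁ hb₁ ha₂ hb₂ hbox g g' hL hL' hF hc hN htw
  refine weilFourfoldsSplit_of_reach_of_perfectComplexRankTransfer_of_extRank_eq hF' hT hd P ψ₀ e a hP hψ ha ha0 hhyp
    w hwW hwr hw0 I hI E hE q cq hch2 hchp G hext hneg h0 ?_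
  rw [hr, Cardinal.lift_ofNat]
  exact h2

end G4

/-! ## Audit: nothing is decided here

KERNEL: `r(P, ch E) = 18` from the class shape (p4 point-pair box on the source ∘ THIS partial-Fourier transport ∘ p6 twist),
composed into p7's functor-free row. BY VALUE: the source splitting and box coefficients, `g`, `g'`, `hL`, `hL'`, `hF`, `htw`,
the Weil datum, the Chern data, `extRank … 0 = 1`, `extRank … 2 ≤ 18` (= `dim Ext² = 18`), `hext`. BY NAME:
`weilFamilyReach_hyperbolic` (refereed), `PerfectComplexRankTransfer C` (assumption; no kernel link to Pridham / Perry — F-1). -/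

end Summit.Ventures.HSemireg

end
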